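import Literature.NumberTheory.Sieve.RoughDivisorPowerSums
import HarnessLib

/-!
# Two estimates for the error sums of the iterated `β`-sieve: window products `∏_{w ≤ p ≤ x} (1 + c/p)` and geometric tails

Topic `Literature/NumberTheory/Sieve`, namespace `BetaSieve`. Everything in this file is PROVED.
These are the two elementary estimates with which Matomäki–Merikoski (arXiv:2112.11412, §3.2, proof of
Lemma 3.2) pass from the structural error terms of the iterated `β`-sieve
(`BetaSievePointwise.lean`, `BetaSieveMainTermSigned.lean`: sums over `r` of
`2^{−Ar} ∏_{z_r ≤ p < z} (1 + c/p)`, `z_r = z^{((β−1)/β)^r}`, restricted to `log D < (r + β) log z`)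
to the printed `O_{β,A}(e^{−Aθu/2})`:

* `BetaSieve.prod_one_add_div_le` — **Mertens in a window, product form**
  ("(eq:Mertens): `∏_{w < p ≤ z} (1 + k/p) ≍ (log z/log w)^k`", upper half): for `c ≥ 0`, real
  `1 < w ≤ x` and any set `S` of primes `p` with `w ≤ p ≤ x`,
  `∏_{p ∈ S} (1 + c/p) ≤ e^{25c} (log x/log w)^c` (from the tree's
  `RoughSums.sum_primesGe_inv_le`: `∑_{w ≤ p ≤ x} 1/p ≤ log(log x/log w) + 25`);
* `BetaSieve.sum_Icc_indicator_pow_le` — **geometric tails**: for `0 < q < 1` and real `s`,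
  `∑_{1 ≤ r ≤ R, s < r} q^r ≤ q^s/(1 − q)` ("`∑_{r ≥ uθ−β} 2^{−Ar} (β/(β−1))^{cr} ≪_{β,A} 2^{−0.9Auθ}`"
  once `β` is large in terms of `A`).

## References

* K. Matomäki, J. Merikoski, IMRN 2023 (arXiv:2112.11412), §3.1 (eq:Mertens) and §3.2 (end of the
  proof of Lemma 3.2). [cite: MatomakiMerikoski2023, §3.2]
-/

noncomputable section

open Finset Real

namespace Literature.NumberTheory.Sieve

namespace BetaSieve

/-! ### Window products -/

/-- **`∏_{p ∈ S} (1 + c/p) ≤ e^{25c} (log x/log w)^c`** for `c ≥ 0`, `1 < w ≤ x` and `S` a set of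
primes in `[w, x]`. [cite: MatomakiMerikoski2023, §3.1 (eq:Mertens)] -/
theorem prod_one_add_div_le {c : ℝ} (hc : 0 ≤ c) {w x : ℝ} (hw : 1 < w) (hwx : w ≤ x)
    {S : Finset ℕ} (hS : ∀ p ∈ S, p.Prime ∧ w ≤ (p : ℝ) ∧ (p : ℝ) ≤ x) :
    ∏ p ∈ S, (1 + c / (p : ℝ)) ≤ Real.exp (25 * c) * (Real.log x / Real.log w) ^ c := by
  have hw0 : 0 < w := by linarith
  have hx0 : 0 < x := by linarith
  have hlogw : 0 < Real.log w := Real.log_pos hw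
  have hlogx : 0 < Real.log x := Real.log_pos (by linarith)
  have ht0 : 0 < Real.log x / Real.log w := div_pos hlogx hlogw
  -- `S` inside the window of `sum_primesGe_inv_le`
  have hsub : S ⊆ (Nat.primesLE ⌊x⌋₊).filter (fun p : ℕ => w ≤ (p : ℝ)) := by
    intro p hp
    obtain ⟨hpp, hwp, hpx⟩ := hS p hp
    rw [Finset.mem_filter, Nat.mem_primesLE]
    exact ⟨⟨Nat.le_floor hpx, hpp⟩, hwp⟩
  have hsum : ∑ p ∈ S, (p : ℝ)⁻¹ ≤ Real.log (Real.log x / Real.log w) + 25 :=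
    (Finset.sum_le_sum_of_subset_of_nonneg hsub fun p _ _ => inv_nonneg.mpr (Nat.cast_nonneg p)).trans
      (RoughSums.sum_primesGe_inv_le hw hwx)
  -- `∏ (1 + c/p) ≤ exp(c ∑ 1/p)`
  have h1 : ∏ p ∈ S, (1 + c / (p : ℝ)) ≤ Real.exp (∑ p ∈ S, c * (p : ℝ)⁻¹) := by
    rw [Real.exp_sum]
    refine Finset.prod_le_prod (fun p _ => by positivity) fun p hp => ?_
    rw [div_eq_mul_inv]
    linarith [Real.add_one_le_exp (c * (p : ℝ)⁻¹)]
  refine h1.trans ?_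
  rw [← Finset.mul_sum]
  calc Real.exp (c * ∑ p ∈ S, (p : ℝ)⁻¹) ≤ Real.exp (c * (Real.log (Real.log x / Real.log w) + 25)) :=
        Real.exp_le_exp.mpr (mul_le_mul_of_nonneg_left hsum hc)
    _ = Real.exp (25 * c) * (Real.log x / Real.log w) ^ c := by
        rw [mul_add, Real.exp_add, Real.rpow_def_of_pos ht0, mul_comm (Real.log _) c]
        ring

/-- The window of the iterated sieve: for `z > 1`, `0 < θ' ≤ 1` and `r : ℕ`,
`log z / log (z^{θ'^r}) = (1/θ')^r`, and `1 < z^{θ'^r} ≤ z`. [folklore] -/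
theorem log_div_log_rpow_pow {z θ' : ℝ} (hz : 1 < z) (hθ0 : 0 < θ') (hθ1 : θ' ≤ 1) (r : ℕ) :
    Real.log z / Real.log (z ^ (θ' ^ r)) = (1 / θ') ^ r ∧ 1 < z ^ (θ' ^ r) ∧ z ^ (θ' ^ r) ≤ z := by
  have hz0 : 0 < z := by linarith
  have hlogz : 0 < Real.log z := Real.log_pos hz
  have hpow : 0 < θ' ^ r := pow_pos hθ0 r
  refine ⟨?_, Real.one_lt_rpow hz hpow, ?_⟩
  · rw [Real.log_rpow hz0, one_div, inv_pow]
    field_simp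
  · conv_rhs => rw [← Real.rpow_one z]
    exact Real.rpow_le_rpow_of_exponent_le hz.le (pow_le_one₀ hθ0.le hθ1)

/-! ### Geometric tails -/

/-- **`∑_{1 ≤ r ≤ R, s < r} q^r ≤ q^s/(1 − q)`** for `0 < q < 1` and real `s` (the contributing `r` are
the integers of `(s, R]`; the first of them is `≥ s`). [cite: MatomakiMerikoski2023, §3.2] -/
theorem sum_Icc_indicator_pow_le {q : ℝ} (hq0 : 0 < q) (hq1 : q < 1) (s : ℝ) (R : ℕ) :
    ∑ r ∈ Icc 1 R, (if s < (r : ℝ) then q ^ r else 0) ≤ q ^ s / (1 - q) := by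
  have h1q : 0 < 1 - q := by linarith
  have hRHS : 0 ≤ q ^ s / (1 - q) := div_nonneg (Real.rpow_nonneg hq0.le s) h1q.le
  rw [← Finset.sum_filter]
  set S' : Finset ℕ := (Icc 1 R).filter (fun r : ℕ => s < (r : ℝ)) with hS'
  rcases S'.eq_empty_or_nonempty with hE | hne
  · rw [hE, Finset.sum_empty]; exact hRHS
  · set r₀ : ℕ := S'.min' hne with hr₀
    have hr₀mem : r₀ ∈ S' := Finset.min'_mem S' hne
    have hr₀s : s < (r₀ : ℝ) := (Finset.mem_filter.mp hr₀mem).2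
    have hsub : S' ⊆ Finset.Ico r₀ (R + 1) := by
      intro r hr
      rw [Finset.mem_Ico]
      exact ⟨Finset.min'_le S' r hr, Nat.lt_succ_of_le (Finset.mem_Icc.mp (Finset.mem_filter.mp hr).1).2⟩
    calc ∑ r ∈ S', q ^ r ≤ ∑ r ∈ Finset.Ico r₀ (R + 1), q ^ r :=
          Finset.sum_le_sum_of_subset_of_nonneg hsub fun r _ _ => pow_nonneg hq0.le r
      _ = q ^ r₀ * ∑ j ∈ Finset.range (R + 1 - r₀), q ^ j := by
          rw [Finset.sum_Ico_eq_sum_range, Finset.mul_sum]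
          refine Finset.sum_congr rfl fun j _ => ?_
          rw [pow_add]
      _ ≤ q ^ r₀ * (1 / (1 - q)) := by
          refine mul_le_mul_of_nonneg_left ?_ (pow_nonneg hq0.le _)
          have hgeom : ∑ j ∈ Finset.range (R + 1 - r₀), q ^ j = (1 - q ^ (R + 1 - r₀)) / (1 - q) := by
            rw [geom_sum_eq hq1.ne]
            have hq1' : q - 1 ≠ 0 := by linarith
            field_simp
            ring
          rw [hgeom]
          exact div_le_div_of_nonneg_right (by linarith [pow_nonneg hq0.le (R + 1 - r₀)]) h1q.le
      _ ≤ q ^ s * (1 / (1 - q)) := by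
          refine mul_le_mul_of_nonneg_right ?_ (by positivity)
          rw [← Real.rpow_natCast]
          exact Real.rpow_le_rpow_of_exponent_ge hq0 hq1.le hr₀s.le
      _ = q ^ s / (1 - q) := by ring

end BetaSieve

end Literature.NumberTheory.Sieve
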